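import Summits.AtomisticToContinuum.HydrodynamicLimit.Theorems.MourreKoopmanChargesOneBodyCompletenessGibbsNorm
import Summits.AtomisticToContinuum.HydrodynamicLimit.Theorems.MourreKoopmanChargesOneBodyCompletenessTorusStatics
import Summits.AtomisticToContinuum.HydrodynamicLimit.Theorems.MourreKoopmanChargesOneBodyCompletenessReduction
import HarnessLib

/-!
# `OneBodyCompleteness` (crux stmt-AtomisticToContinuum-9583, route `MourreKoopmanCharges`):
# the torus ↔ infinite-volume identification holds at time zero, with constant `K = σ⁻³`

Helper file (`--supports stmt-AtomisticToContinuum-9583`, line `registered`, skeleton v5 of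
`Cruxes/OneBodyCompleteness/Lines/birth.lean`). The registered identification stub
`stub_torusIdentificationUnit` asserts, for a unit-diameter unit-inverse-temperature Gibbs fluctuation
datum `F` of density `σ³` and a profile `h ⊥ {1, v, |v|²}` in `L²(M_θ)`, the convergence
`(N+1)·cov_{G_N(σ,θ)}(A_h(χ)∘Φ_{s(N+1)^{-1/3}}, A_h(χ)) → (∫χ²)·K·⟪U_{(√θ/σ)s}[A_{h_θ}], [A_{h_θ}]⟫`
for some constant `K` and every microscopic time `s`. This file PROVES its time-zero instance with the
explicit constant `K = σ⁻³` (`torusIdentificationUnit_static`): the torus side is the constant sequence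
`(∫χ²)·∫ h² M_θ` (cov = raw moment, `stub_torusMoments`; exact equal-time statics,
`torusStaticVariance`), and the infinite-volume side is `(∫χ²)·σ⁻³·‖[A_{h_θ}]‖² = (∫χ²)·∫ h² M_θ` by the
Campbell/intensity computation `normSq_fluct_cellObs_eq` (`‖[A_g]‖² = σ³∫g²M_1`) and the change of
temperature `∫ h_θ² M_1 = ∫ h² M_θ`. So the scaling dictionary of the line (unit spheres at density
`σ³`, `M_1` velocities, `h_θ = h(√θ·)`) has the right normalisation; only the dynamical (`s ≠ 0`)
content of the identification remains open.

References: H. Spohn, *Large Scale Dynamics of Interacting Particles* (1991), Part I §7.1 (7.6)–(7.7),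
(7.14)–(7.15); J. L. Lebowitz, J. K. Percus, L. Verlet, Phys. Rev. 153 (1967) 250.
-/

noncomputable section

namespace Summit.AtomisticToContinuum.HydrodynamicLimit.Theorems.MourreKoopmanChargesOneBodyCompleteness

open scoped BigOperators Topology InnerProductSpace ENNReal
open Filter Set Function MeasureTheory ProbabilityTheory

/-- **The identification at time zero, `K = σ⁻³`** (the `s = 0` instance of the registered stub
`stub_torusIdentificationUnit`, proved): for `0 < σ < 1/2`, `z, θ > 0`, a unit-diameter Gibbs datum `F`
(`IsHardSphereGibbs 1 z 1 0 F.μ`) of density `σ³`, a continuous polynomially bounded `h ⊥ 1` in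
`L²(M_θ)` with `A_{h_θ} ∈ 𝒱`, every flow family and continuous `χ`, the (constant) sequence
`(N+1)·cov_{G_N}(A_h(χ)∘Φ_{0·(N+1)^{-1/3}}, A_h(χ))` tends to
`(∫χ²)·(σ³)⁻¹·⟪U_{(√θ/σ)·0}[A_{h_θ}], [A_{h_θ}]⟫_{ℋ_F}` — both sides equal `(∫χ²)·∫ h² M_θ`.
[Spohn1991 Part I §7.1 (7.6)–(7.7); folklore] -/
theorem torusIdentificationUnit_static :
    ∀ σ : ℝ, 0 < σ → σ < 1 / 2 → ∀ z : ℝ, 0 < z → ∀ θ : ℝ, 0 < θ →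
      ∀ F : Literature.MathematicalPhysics.KineticTheory.HardSphereFluctuationData 1,
        Literature.Analysis.FluidPDE.IsHardSphereGibbs 1 z 1
          (0 : Literature.MathematicalPhysics.KineticTheory.V3) F.μ →
        (∫ ω, Literature.MathematicalPhysics.KineticTheory.cellCharge 0 ω ∂F.μ = σ ^ 3) →
        ∀ h : Literature.MathematicalPhysics.KineticTheory.V3 → ℝ, Continuous h →
          (∃ (C : ℝ) (k : ℕ), ∀ v, |h v| ≤ C * (1 + ‖v‖) ^ k) →
          Literature.MathematicalPhysics.KineticTheory.cellObs (fun w => h (Real.sqrt θ • w)) ∈ F.localObs →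
          (∫ v, h v * Literature.Analysis.FluidPDE.localMaxwellian 1 θ
              (0 : Literature.MathematicalPhysics.KineticTheory.V3) v = 0) →
          ∀ Φ : (N : ℕ) → Literature.Analysis.FluidPDE.HardSphereFlow
              (Literature.Analysis.FluidPDE.Torus.geometry (Fin 3))
              (Literature.MathematicalPhysics.KineticTheory.hsDiameter σ N) (N + 1),
          ∀ χ : Literature.MathematicalPhysics.KineticTheory.T3 → ℝ, Continuous χ →
            Tendsto (fun N : ℕ => ((N : ℝ) + 1) *
                cov[fun z => ∫ y, χ y.1 * h y.2 ∂(Literature.Analysis.FluidPDE.empiricalMeasure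
                      ((Φ N).flow (0 * ((N : ℝ) + 1) ^ (-(1 / 3 : ℝ))) z)),
                    fun z => ∫ y, χ y.1 * h y.2 ∂(Literature.Analysis.FluidPDE.empiricalMeasure z);
                  Literature.MathematicalPhysics.KineticTheory.localGibbsLaw σ (fun _ => 1)
                    (fun _ => 0) (fun _ => θ) N (Φ N)])
              atTop (𝓝 ((∫ x, χ x * χ x) * (σ ^ 3)⁻¹ *
                ⟪F.koopman (Real.sqrt θ / σ * 0)
                    (F.fluct (Literature.MathematicalPhysics.KineticTheory.cellObs
                      (fun w => h (Real.sqrt θ • w)))),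
                  F.fluct (Literature.MathematicalPhysics.KineticTheory.cellObs
                    (fun w => h (Real.sqrt θ • w)))⟫_ℝ)) := by
  intro σ hσ hσhalf z hz θ hθ F hG hdens h hh hb hmem hm0 Φ χ hχ
  -- the rescaled profile h_θ
  have hhθ : Continuous fun w : Literature.MathematicalPhysics.KineticTheory.V3 => h (Real.sqrt θ • w) :=
    hh.comp (continuous_const_smul (Real.sqrt θ))
  have hbθ := poly_bound_comp_sqrt (θ := θ) hb
  have hm0' : ∫ w, h (Real.sqrt θ • w) * Literature.Analysis.FluidPDE.localMaxwellian 1 1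
      (0 : Literature.MathematicalPhysics.KineticTheory.V3) w = 0 := by
    rw [← integral_mul_localMaxwellian_eq_comp_sqrt hθ h]; exact hm0
  -- torus side: the sequence is constant
  have hval : ∀ N : ℕ, ((N : ℝ) + 1) *
      cov[fun z => ∫ y, χ y.1 * h y.2 ∂(Literature.Analysis.FluidPDE.empiricalMeasure
            ((Φ N).flow (0 * ((N : ℝ) + 1) ^ (-(1 / 3 : ℝ))) z)),
          fun z => ∫ y, χ y.1 * h y.2 ∂(Literature.Analysis.FluidPDE.empiricalMeasure z);
        Literature.MathematicalPhysics.KineticTheory.localGibbsLaw σ (fun _ => 1)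
          (fun _ => 0) (fun _ => θ) N (Φ N)] =
      (∫ x, χ x * χ x) * ∫ v, h v ^ 2 * Literature.Analysis.FluidPDE.localMaxwellian 1 θ
        (0 : Literature.MathematicalPhysics.KineticTheory.V3) v := by
    intro N
    rw [zero_mul, (stub_torusMoments σ hσ hσhalf θ hθ h hh hb hm0 N (Φ N) χ hχ 0).1]
    exact torusStaticVariance σ hσ hσhalf θ hθ h hh hb hm0 N (Φ N) χ hχ
  -- infinite-volume side: σ⁻³ ‖[A_{h_θ}]‖² = ∫ h_θ² M_1 = ∫ h² M_θ
  have hlim : (∫ x, χ x * χ x) * (σ ^ 3)⁻¹ *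
      ⟪F.koopman (Real.sqrt θ / σ * 0)
          (F.fluct (Literature.MathematicalPhysics.KineticTheory.cellObs
            (fun w => h (Real.sqrt θ • w)))),
        F.fluct (Literature.MathematicalPhysics.KineticTheory.cellObs
          (fun w => h (Real.sqrt θ • w)))⟫_ℝ =
      (∫ x, χ x * χ x) * ∫ v, h v ^ 2 * Literature.Analysis.FluidPDE.localMaxwellian 1 θ
        (0 : Literature.MathematicalPhysics.KineticTheory.V3) v := by
    have hσ3 : σ ^ 3 ≠ 0 := by positivity
    rw [mul_zero, Literature.MathematicalPhysics.KineticTheory.FluctuationDynamics.koopman_zero_apply,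
      real_inner_self_eq_norm_sq,
      normSq_fluct_cellObs_eq z σ hz hσ F hG hdens (fun w => h (Real.sqrt θ • w)) hhθ hbθ hmem hm0',
      integral_mul_localMaxwellian_eq_comp_sqrt hθ (fun v => h v ^ 2)]
    field_simp
  rw [show (fun N : ℕ => ((N : ℝ) + 1) *
      cov[fun z => ∫ y, χ y.1 * h y.2 ∂(Literature.Analysis.FluidPDE.empiricalMeasure
            ((Φ N).flow (0 * ((N : ℝ) + 1) ^ (-(1 / 3 : ℝ))) z)),
          fun z => ∫ y, χ y.1 * h y.2 ∂(Literature.Analysis.FluidPDE.empiricalMeasure z);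
        Literature.MathematicalPhysics.KineticTheory.localGibbsLaw σ (fun _ => 1)
          (fun _ => 0) (fun _ => θ) N (Φ N)]) =
      fun _ => (∫ x, χ x * χ x) * ∫ v, h v ^ 2 * Literature.Analysis.FluidPDE.localMaxwellian 1 θ
        (0 : Literature.MathematicalPhysics.KineticTheory.V3) v from funext hval, hlim]
  exact tendsto_const_nhds

end Summit.AtomisticToContinuum.HydrodynamicLimit.Theorems.MourreKoopmanChargesOneBodyCompleteness

end
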